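import Summits.QuantumFields.YangMills.Theorems.UnitScaleTiltFluctuationComparisonRegPrIntLOneSupplierV4
import Summits.QuantumFields.YangMills.Theorems.UnitScaleTiltFluctuationComparisonRegPrGlobalSlackKernelLegDisplayV4
import HarnessLib

/-!
# `UnitScaleTiltFluctuationComparisonRegPrIntLOneSupplierDisplayV4` — THE v4 TWIN (★★OWNER RULING g26-№14 (F-2b); P22b display branch, width seat ym-ust-20520-w2 g4; skeleton v5kD; record-free decls imported from `…IntLOneSupplierDisplay`) of `…IntLOneSupplierDisplay` — THE DECIDING CRUX `FluctuationComparisonRegPrIntL` FROM 19200's FIVE v8 LEAVES, THE χ-RECORD, AND THE PER-RUN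
# DISPLAY OBLIGATION `K1aLegRowsDisplayChiV4` AT EVERY ODD BLOCK SIZE (crux stmt-QuantumFields-20520, skeleton v5kC; width-lever lane B «(R1) print's χ of [Balaban1985UV3] (47) back»,
# seat ym-ust-19935-r1 g5; companion of `…IntLOneSupplier`)

ym-ust-20520-w1 g0's capstone (`…GlobalSlackKernelLegDisplay`, p586902) states 3⁗χ's content as ONE per-run display obligation `K1aLegRowsDisplayChiV4 L 𝔠 a₀ a₁ a` — seven rows, each about
ONE run's χ-package: (R1) `KernelRefOwnΦ`, (R2′) leg-weighted analyticity, (N) `NewLevelIsBirthRows`, (M1) `OldTermsAreJetsOwnRows`, (F^Λ) `LambdaFarSmallOwnRows`, (R4) `CfgDistOwnΦ`, (R5) `CfgRefOwnΦ` —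
and proves `K1aLegRowsDisplayChiV4 ⟹ K1aLegRowsOwnAChiV4 ⟹ K1aLegRowsOwnEChiV4 ⟹ K1aLegRowsEChiV4 ⟹ K1aChartRowsKChiV4` (`…KernelLegWeighted`).  None of the seven rows mentions a block-size
threshold.  With `…IntLOneSupplier` (p588274: ONE block-size-uniform chart predicate serves 3⁗χ AND (i*)χ) this gives:

* `k1aChartRowsKChiV4_of_displayChiV4` (the four-step chain as one arrow, for `0 < a`);
* **`regPrIntL_of_v8Leaves_recChiV4_k1aLegRowsDisplayChiV4_allL`** : halving → PV3A → PV3C → PV3D → PV3E → 2′χ → (∀ odd `L > 1`, ∀ 𝔠 a₀ a₁ …, ∃ a ∈ (0,1), `K1aLegRowsDisplayChiV4 L 𝔠 a₀ a₁ a`) →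
  `FluctuationComparisonRegPrIntL`.
So the deciding crux's whole analytic residue, BY NAME, is {19200 v8's five registered stubs, 2′χ = NODE O's χ-record, the per-run display obligation at every odd `L > 1`} — the last being
exactly the list a v4 (α) record has to show (w1's memo `WHAT-3CHI-IS-PER-RUN-w1g0-v3.md`), with no separate small-block mathematics.  HONEST FRAMING: composition of landed theorems;
nothing of [Balaban1985UV3]/[King1986] asserted; registry untouched (`--supports stmt-QuantumFields-20520`); YM₃ on T³ is a rung, not the Clay problem / a gap.

References: T. Bałaban, CMP 102 (1985) 255–275 [Balaban1985UV3] ((25) p.262, (43)–(47) pp.266–267, (57) p.270, (61)–(63) pp.271–272); CMP 102 (1985) 277–309 [Balaban1985Variational]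
(Thm 1 (8) p.279, Prop. 2 p.281, Props 5–6 pp.294–296, Prop. 7 p.299, Prop. 8 p.304); C. King, CMP 102 (1986) 649–677 [King1986] (Thm 3.4 (3.9) p.656, Prop. 3.6 (3.56) p.662, Prop. 3.9
(3.73)–(3.75) p.665).
-/

set_option autoImplicit false

noncomputable section

namespace Summit.QuantumFields.YangMills.Theorems.InteriorExcision

open Literature.MathematicalPhysics.QuantumFieldTheory.Balaban1983to89
open Literature.MathematicalPhysics.QuantumFieldTheory.Balaban1983to89.T3ContinuumYM3Torus
open Literature.MathematicalPhysics.QuantumFieldTheory.Balaban1983to89.T3UnitLawDensityEML (ℰp)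
open Literature.MathematicalPhysics.QuantumFieldTheory.Balaban1983to89.T3InteriorExcision
open Literature.MathematicalPhysics.QuantumFieldTheory.Balaban1983to89.T3PrintedRegularMinimiser
open Literature.MathematicalPhysics.QuantumFieldTheory.Balaban1983to89.T3ConstrainedMinimiser (fibre)
open Literature.MathematicalPhysics.QuantumFieldTheory.Balaban1983to89.T3Thm1Carrier (famX Idx)
open Literature.MathematicalPhysics.QuantumFieldTheory.Balaban1983to89.T3Thm1CarrierNative (IsCritR2)
open Literature.MathematicalPhysics.QuantumFieldTheory.Balaban1983to89.T3SectALandauChart (ResidFam famLG3 In19 CloseAvg emb15)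
open Literature.MathematicalPhysics.QuantumFieldTheory.Balaban1983to89.B11 (Prop2Printed)
open Summit.QuantumFields.Balaban3D.Carriers
open Summit.QuantumFields.Balaban3D.Proofs.Primitives
open Summit.QuantumFields.YangMills.Theorems.Prop7TPrint (nMax19 expHermField)
open Summit.QuantumFields.YangMills.Theorems.Prop7SPrint (sPrint RestrictedPrint AvgCondPrint IsLandauPrint CritLPrint)
open Summit.QuantumFields.YangMills.Theorems.GlobalSlackCanonicalPolymers (K1aChartRowsKChiV4)
open Summit.QuantumFields.YangMills.Theorems.GlobalSlackKernelLeg (K1aLegRowsDisplayChiV4 k1aLegRowsOwnAChiV4_of_displayV4 k1aLegRowsOwnEChiV4_of_OwnAChiV4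
  k1aLegRowsEChiV4_of_OwnEChiV4 k1aChartRowsKChiV4_of_legRowsEChiV4)

/-- **THE PER-RUN DISPLAY OBLIGATION GIVES THE FULL-WINDOW χ-CHART ROWS** (ym-ust-20520-w1 g0's four arrows as one, rate `0 < a`): `K1aLegRowsDisplayChiV4 ⟹ K1aLegRowsOwnAChiV4 ⟹ K1aLegRowsOwnEChiV4 ⟹
K1aLegRowsEChiV4 ⟹ K1aChartRowsKChiV4`.  No block-size hypothesis. [cite: Balaban1985UV3, (25) p.262, (43)-(45) pp.266-267, (57) p.270; King1986, Prop. 3.6 (3.56) p.662, Prop. 3.9 (3.73)-(3.75) p.665] -/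
theorem k1aChartRowsKChiV4_of_displayChiV4 {L : ℕ} {𝔠 : AlphaConsts L (suGroupModel 2).N} {a₀ a₁ a : ℝ} (ha : 0 < a) (h : K1aLegRowsDisplayChiV4 L 𝔠 a₀ a₁ a) :
    K1aChartRowsKChiV4 L 𝔠 a₀ a₁ a :=
  k1aChartRowsKChiV4_of_legRowsEChiV4 (k1aLegRowsEChiV4_of_OwnEChiV4 ha.le (k1aLegRowsOwnEChiV4_of_OwnAChiV4 (k1aLegRowsOwnAChiV4_of_displayV4 h)))

/-- **THE DECIDING CRUX FROM 19200's FIVE v8 LEAVES, THE χ-RECORD AND THE PER-RUN DISPLAY OBLIGATION AT EVERY ODD BLOCK SIZE**: V2′, P-V3-A/C/D/E, 2′χ and — for every odd `L > 1`,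
every constants record and [7]-constants — a rate exponent `0 < a < 1` with w1's seven per-run display rows `K1aLegRowsDisplayChiV4 L 𝔠 a₀ a₁ a` give `FluctuationComparisonRegPrIntL`
(`regPrIntL_of_v8Leaves_recChiV4_k1aChartRowsKChiV4_allL ∘ k1aChartRowsKChiV4_of_displayChiV4`). [cite: Balaban1985UV3, (41) p.266, (43)-(47) pp.266-267, (57) p.270, (61)-(63) pp.271-272, Thm 2 p.272; Balaban1985Variational, Thm 1 (8) p.279, Prop. 2 p.281, Props 5-6 pp.294-296, Prop. 7 p.299, Prop. 8 p.304; King1986, Thm 3.4 (3.9) p.656, Prop. 3.6 (3.56) p.662, Prop. 3.9 (3.73)-(3.75) p.665] -/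
theorem regPrIntL_of_v8Leaves_recChiV4_k1aLegRowsDisplayChiV4_allL
    (hV2 : ∀ (L : ℕ), 1 < L → ∃ B₃ : ℝ, 4 < B₃ ∧ ∃ a₅ : ℝ, 0 < a₅ ∧
      ∀ (i : Idx L) (ε₀ ε₁ : ℝ), 0 < ε₁ → ∀ (V : (famX L i).Bdry) (U : (famX L i).Cfg), (famX L i).Reg7 ε₁ V → (famX L i).InU ε₀ U →
        (famX L i).InB V U → (famX L i).IsCritical V U → ε₀ ≤ a₅ → (famX L i).InU (max (B₃ * ε₁) (ε₀ / 2)) U)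
    (hA : ∀ (L : ℕ), 1 < L → ∀ (T : ResidFam L) (B₃ : ℝ), 4 < B₃ →
      ∃ B₁ c₁ : ℝ, 0 < B₁ ∧ 0 < c₁ ∧ Prop2Printed B₁ B₃ ((L : ℝ) ^ 3) c₁ (famLG3 L (sPrint L T)))
    (hC : ∀ (L : ℕ), 1 < L → ∀ (B₃ : ℝ), 4 < B₃ →
      ∃ B₀ a₄ : ℝ, 0 < B₀ ∧ 0 < a₄ ∧ ∀ (i : Idx L) (ε₁ ε₄ : ℝ), 0 < ε₁ → ε₄ ≤ a₄ → 2 * B₀ * (L : ℝ) ^ 3 * B₃ * ε₁ ≤ ε₄ →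
        ∀ (V : GaugeField (i.1.1.P i.1.2.1) 0 (Matrix.specialUnitaryGroup (Fin 2) ℂ))
          (U₀ : GaugeField (i.1.1.P i.1.2.2) 0 (Matrix.specialUnitaryGroup (Fin 2) ℂ)),
          RegPr i.1.1 i.1.2.1 i.1.2.2 ((L : ℝ) ^ 3 * B₃ * ε₁) U₀ → CloseAvg i.1.1 i.1.2.1 i.1.2.2 i.2.2.le ((L : ℝ) ^ 3 * ε₁) V U₀ →
          ∃ X : PBond (i.1.1.P i.1.2.2) 0 → Matrix (Fin 2) (Fin 2) ℂ,
            nMax19 i.1.1 i.1.2.1 i.1.2.2 U₀ X < ε₄ ∧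
            ((∀ b : PBond (i.1.1.P i.1.2.2) 0, (X b).IsHermitian ∧ Matrix.trace (X b) = 0) ∧ AvgCondPrint i.1.1 i.1.2.1 i.1.2.2 i.2.2.le V U₀ X ∧
              IsLandauPrint i.1.1 i.1.2.1 i.1.2.2 U₀ X ∧ CritLPrint i.1.1 i.1.2.1 i.1.2.2 i.2.2.le V U₀ (expHermField X)) ∧
            nMax19 i.1.1 i.1.2.1 i.1.2.2 U₀ X < 3 * B₀ * (L : ℝ) ^ 3 * B₃ * ε₁ ∧
            ∀ X' : PBond (i.1.1.P i.1.2.2) 0 → Matrix (Fin 2) (Fin 2) ℂ, nMax19 i.1.1 i.1.2.1 i.1.2.2 U₀ X' < ε₄ →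
              ((∀ b : PBond (i.1.1.P i.1.2.2) 0, (X' b).IsHermitian ∧ Matrix.trace (X' b) = 0) ∧ AvgCondPrint i.1.1 i.1.2.1 i.1.2.2 i.2.2.le V U₀ X' ∧
                IsLandauPrint i.1.1 i.1.2.1 i.1.2.2 U₀ X' ∧ CritLPrint i.1.1 i.1.2.1 i.1.2.2 i.2.2.le V U₀ (expHermField X')) → X' = X)
    (hD : ∀ (L : ℕ), 1 < L → ∀ (B₃ : ℝ), 4 < B₃ →
      ∃ O₂ c : ℝ, 1 ≤ O₂ ∧ 0 < c ∧ ∀ (i : Idx L) (ε₁ ε₂ : ℝ) (V : GaugeField (i.1.1.P i.1.2.1) 0 (Matrix.specialUnitaryGroup (Fin 2) ℂ))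
        (U₀ U₁ : GaugeField (i.1.1.P i.1.2.2) 0 (Matrix.specialUnitaryGroup (Fin 2) ℂ)) (X : PBond (i.1.1.P i.1.2.2) 0 → Matrix (Fin 2) (Fin 2) ℂ),
        (L : ℝ) ^ 3 * B₃ * ε₁ ≤ ε₂ → ε₂ ≤ c → RegPr i.1.1 i.1.2.1 i.1.2.2 ((L : ℝ) ^ 3 * B₃ * ε₁) U₀ → CloseAvg i.1.1 i.1.2.1 i.1.2.2 i.2.2.le ((L : ℝ) ^ 3 * ε₁) V U₀ →
        In19 i.1.1 i.1.2.1 i.1.2.2 ε₂ U₀ U₁ X → AvgCondPrint i.1.1 i.1.2.1 i.1.2.2 i.2.2.le V U₀ X → IsLandauPrint i.1.1 i.1.2.1 i.1.2.2 U₀ X →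
        CritLPrint i.1.1 i.1.2.1 i.1.2.2 i.2.2.le V U₀ U₁ →
          ∃ u : GaugeTransf (i.1.1.P i.1.2.2) 0 (Matrix.specialUnitaryGroup (Fin 2) ℂ), RestrictedPrint i.1.1 i.1.2.1 i.1.2.2 U₀ u ∧
            RegPr i.1.1 i.1.2.1 i.1.2.2 (O₂ * ε₂) (GaugeField.gaugeAct u (emb15 U₀ U₁)) ∧
            GaugeField.gaugeAct u (emb15 U₀ U₁) ∈ fibre i.1.1 ℰp i.1.2.1 i.1.2.2 i.2.2.le V ∧
            IsCritR2 i.1.1 i.1.2.1 i.1.2.2 i.2.2.le V (GaugeField.gaugeAct u (emb15 U₀ U₁)))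
    (hE : ∀ (L : ℕ), 1 < L → ∀ (B₃ : ℝ), 4 < B₃ →
      ∃ e₅ : ℝ, 0 < e₅ ∧ ∀ (i : Idx L) (e ε₁ : ℝ) (V : GaugeField (i.1.1.P i.1.2.1) 0 (Matrix.specialUnitaryGroup (Fin 2) ℂ))
        (U₀ U₁ : GaugeField (i.1.1.P i.1.2.2) 0 (Matrix.specialUnitaryGroup (Fin 2) ℂ)) (u : GaugeTransf (i.1.1.P i.1.2.2) 0 (Matrix.specialUnitaryGroup (Fin 2) ℂ)),
        e ≤ e₅ → RegPr i.1.1 i.1.2.1 i.1.2.2 ((L : ℝ) ^ 3 * B₃ * ε₁) U₀ → CloseAvg i.1.1 i.1.2.1 i.1.2.2 i.2.2.le ((L : ℝ) ^ 3 * ε₁) V U₀ →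
        CritLPrint i.1.1 i.1.2.1 i.1.2.2 i.2.2.le V U₀ U₁ → RestrictedPrint i.1.1 i.1.2.1 i.1.2.2 U₀ u →
        RegPr i.1.1 i.1.2.1 i.1.2.2 e (GaugeField.gaugeAct u (emb15 U₀ U₁)) →
        GaugeField.gaugeAct u (emb15 U₀ U₁) ∈ fibre i.1.1 ℰp i.1.2.1 i.1.2.2 i.2.2.le V →
        IsCritR2 i.1.1 i.1.2.1 i.1.2.2 i.2.2.le V (GaugeField.gaugeAct u (emb15 U₀ U₁)) →
          GaugeField.gaugeAct u (emb15 U₀ U₁) ∈ regFibrePr i.1.1 i.1.2.1 i.1.2.2 i.2.2.le e V ∧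
          IsMinOn (fun W : GaugeField (i.1.1.P i.1.2.2) 0 (Matrix.specialUnitaryGroup (Fin 2) ℂ) => wilsonAction4 W)
            (regFibrePr i.1.1 i.1.2.1 i.1.2.2 i.2.2.le e V) (GaugeField.gaugeAct u (emb15 U₀ U₁)))
    (h2 : ∀ L : ℕ, Odd L → 1 < L → Summit.QuantumFields.YangMills.Theorems.AlphaInputsT3ACv4RecChi L)
    (hDisp : ∀ (L : ℕ), Odd L → 1 < L → ∀ (𝔠 : AlphaConsts L (suGroupModel 2).N) (a₀ a₁ : ℝ), 0 < a₀ → 0 < a₁ → 𝔠.B₃ * a₁ ≤ a₀ →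
      ∃ a : ℝ, 0 < a ∧ a < 1 ∧ K1aLegRowsDisplayChiV4 L 𝔠 a₀ a₁ a) :
    FluctuationComparisonRegPrIntL :=
  regPrIntL_of_v8Leaves_recChiV4_k1aChartRowsKChiV4_allL hV2 hA hC hD hE h2 fun L hLo hL1 𝔠 a₀ a₁ ha0 ha1 hw => by
    obtain ⟨a, ha, ha1', hc⟩ := hDisp L hLo hL1 𝔠 a₀ a₁ ha0 ha1 hw
    exact ⟨a, ha, ha1', k1aChartRowsKChiV4_of_displayChiV4 ha hc⟩

end Summit.QuantumFields.YangMills.Theorems.InteriorExcision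

end
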